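/-
Origin: expansion seat `planner-pub-hodgecm-mc-theta-3-g13-0`, handover (SL) 2026-08-20T06:24:57Z md5 07f13a93d51fee50f4c239375ca6d456 (472 l.; NEW additive drop-alone leaf over RUN-42 #1213 `ArchLineSlotTypeEigen`; (J-μ) socket place by place: one-place plane letters on slotTensor/conjSlotTensor ⇒ slot types ⇒ E's hΔₖ differences, + assembly to #1213's torus hypotheses; cert rc 0/35 s/0 warn/0 proof-hole; axioms 25/25 ⊆ trio) (`HOME/mc/pub-hodgecm-mc-theta-3-g13/lean/stage43/HodgeCM/Model/ArchSlotTypeLetters.lean`, md5 07f13a93d51f, 472 lines);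
landed by the gen-16 packager (p-g16) in gate run 43 as `HodgeCM/Model/ArchSlotTypeLetters.lean` (verbatim).
-/
/-
Origin: speedrun cell pub-hodgecm, MODEL-CONSTRUCTION sub-cell, lineage mc-theta-3 (theta supply / second-lift lane, BINDER-OWNERS row 5 `S` slot),
seat planner-pub-hodgecm-mc-theta-3-g13-0 (gen 13), 2026-08-20.  Target in PKG: `HodgeCM/Model/ArchSlotTypeLetters.lean`
(NEW additive drop-alone leaf; imports sinst-1's `Model/ArchLineSlotTypeEigen` (#1213, RUN 42; hence #1208 `…Cont`, #1210 `…Seesaw`, `Model/ArchTypeReadOff`).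
KERNEL only: 0 records / `def … : Prop` / cites, 0 proof holes; intended closure {propext, Classical.choice, Quot.sound}.
-/
import Summits.HodgeConjecture.HodgeCM.Model.ArchLineSlotTypeEigen

/-!
# (J-μ) SOCKET: the slot types `slotTypeVec k w` are the exponents of the BIG pair's ONE-PLACE PLANE LETTERS on ONE vector

The (J-μ) residual of node E (glue-1 #395 / sinst-1 #1212 `SROG`) is the three guarded INTEGER identities
`slotTypeVec V c … k w − slotTypeVec V c … 0 w = μ c k w − μ c 0 w` (`k = 1, 2, 3`, every infinite place `w`).  The individual
types `slotTypeVec k` are `Classical.choose` read-offs (`charArchType`) of the characters `slotChiₖ · lineCₖ`, whose line factors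
depend on the chosen SMALL splittings `hGRₖ`; what is pinned is their reading through the BIG splitting `hGR` (#1210).  This leaf
turns each `slotTypeVec k w` into the statement provers can COMPUTE with binder-2's vacuum-letter engine:

* §1 `charArchType_archCoord`, `charArchType_apply_eq_iff`: a continuous character `c` of `U(1)(L⁺ ⊗ ℝ) = ∏_w U(1)` has type `n` at `w`
  iff `c (archCoord w z) = z ^ n` for all `z ∈ U(1)` (the one-place subtorus `archCoord`, [BtD85 II 8.1] as vendored);
* §2 `slotTensor`, `conjSlotTensor`: the see-saw tensors `φ_{N₀}(Φ₀) ⊗″ φ_{N₁}(Φ₁)` resp. `φ_{N₀}(Φ₂) ⊗″ φ_{N₁}(Φ₃)` of (F1)'s line test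
  functions in the big pair `(U(V), U(W))(𝔸)`'s model of record, and `…_ne_zero` (`N₀, N₁ ≠ 0`; #1213's `cmLineTensorFin_ne_zero`);
* §3 `cmPairRep_planeLetter₀/₁_slotTensor`, `cmPairRep_conjPlaneLetter₀/₁_conjSlotTensor`: the plane letter `(1, (ι_w(z), 1))` resp.
  `(1, (1, ι_w(z)))` of `U(W)(L⁺ ⊗ ℝ)` (resp. its `g₀`-conjugate for the primed basis) acts on that ONE vector through `ω_ψ ∘ s_pair(hGR)`
  — the BIG splitting alone — by `z ^ (slotTypeVec k w)` (#1210 + (F1) `line_hctr` + §1);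
* §4 `slotTypeVec_eq_of_letter` (k = 0 … 3) and `slotTypeVec_sub_eq_of_letters` (k = 1, 2, 3): HENCE if a prover shows the letter acts
  on that vector by `z ^ a`, then `slotTypeVec k w = a`; the (J-μ) differences are differences of two such exponents;
* §5 `planeTorus_slotTensor_of_letters`, `conjPlaneTorus_conjSlotTensor_of_letters`: the per-place letter identities with integer
  TABLES `a₀ a₁` (resp. `a₂ a₃`) ASSEMBLE to the whole-torus eigen-identity `… = (archWeight a₀ t₀ · archWeight a₁ t₁) • …` — literally
  the hypothesis `h` (resp. `h'`) of sinst-1's #1213 `slotTypeVec_sub_eq_of_planeTorus_eigen` / `…_conjPlaneTorus_eigen`; so the two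
  read-off routes (#1213 whole torus, this leaf place by place) are interchangeable, and provers may compute ONE place at a time.

So the (J-μ) residual per place `w` IS: "the exponents of the two one-place plane letters on the nonzero vector `slotTensor`
(resp. `conjSlotTensor`)" — exactly the input shape of binder-2's `exists_vacExponents_…` / `cmPairRepTwist_torus_ins_tprod_of_eigen`
once `slotTensor`'s archimedean component is written as a plane Folland–Fock vector (the remaining Step 1, not done here).
Nothing here is a claim of PerL/QW8; nothing is cited as a fact.
-/

set_option autoImplicit false

noncomputable section

open scoped Matrix Classical
open Literature.NumberTheory.Automorphic Literature.NumberTheory.Weil1964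
open Literature.NumberTheory.GelbartRogawski1991.UnitaryDualPair
open Literature.RepresentationTheory.CompactGroups
open HodgeCM.Adelic HodgeCM.PerL34

namespace HodgeCM.Model.ArchSideTerm

/-! ## §1 types read on the one-place subtori -/

section Generic

variable (L : Type) [Field L] [NumberField L] [NumberField.IsCMField L]

/-- a continuous character on the one-place subtorus at `w`: `c (archCoord w z) = z ^ (charArchType c w)`. -/
theorem charArchType_archCoord (c : ↥(relNormOneInfUnits (↥(NumberField.maximalRealSubfield L)) L) →* ℂ) (hc : Continuous c)
    (w : NumberField.InfinitePlace L) (z : Circle) :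
    c (archCoord L w z) = (((z ^ (charArchType L c hc w) : Circle)) : ℂ) := by
  rw [charArchType_spec L c hc, archWeight_archCoord]

/-- **the type at `w` is read on the one-place subtorus at `w`**: `charArchType c w = n ↔ ∀ z, c (archCoord w z) = z ^ n`. -/
theorem charArchType_apply_eq_iff (c : ↥(relNormOneInfUnits (↥(NumberField.maximalRealSubfield L)) L) →* ℂ) (hc : Continuous c)
    (w : NumberField.InfinitePlace L) (n : ℤ) :
    charArchType L c hc w = n ↔ ∀ z : Circle, c (archCoord L w z) = (((z ^ n : Circle)) : ℂ) := by
  constructor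
  · intro h z
    rw [charArchType_archCoord L c hc, h]
  · intro h
    exact CircleChar.zpow_injective' fun z => Circle.ext (by rw [← charArchType_archCoord L c hc w z, h z])

end Generic

/-! ## §2 the see-saw tensors of (F1)'s line test functions -/

section Plane

variable {L : CMField} {ι₁ : L →+* ℂ} (V : HermSpace3 L ι₁) (S : StubTree.SeesawDatum L)
variable
  (hGR : (cmSplittingDatum (L : Type) finProdFinEquiv (frameD V) (frameD_real V) (frameD_ne V) (dW S) (dW_real S) (dW_ne S)).CompatibleSplitting)
  (hGR₀ : (cmSplittingDatum (L : Type) (e₁) (frameD V) (frameD_real V) (frameD_ne V) (lineVec (L : Type) (dW S 0))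
    (fun _ => dW_real S 0) (fun _ => dW_ne S 0)).CompatibleSplitting)
  (hGR₁ : (cmSplittingDatum (L : Type) (e₁) (frameD V) (frameD_real V) (frameD_ne V) (lineVec (L : Type) (dW S 1))
    (fun _ => dW_real S 1) (fun _ => dW_ne S 1)).CompatibleSplitting)
  (hpos₀ : 0 < HypCensus.cmXW (L : Type) (frameD V) (lineVec (L : Type) (dW S 0)) (fun _ => dW_real S 0) ι₁ (HypCensus.cmPlace (L : Type) ι₁) 0)
  (hpos₁ : 0 < HypCensus.cmXW (L : Type) (frameD V) (lineVec (L : Type) (dW S 1)) (fun _ => dW_real S 1) ι₁ (HypCensus.cmPlace (L : Type) ι₁) 0)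
  (h₁W : (∀ j, 0 < (ι₁ (dW S j)).re) ∨ ∀ j, (ι₁ (dW S j)).re < 0)

/-- **the slot tensor** `φ_{N₀}(Φ₀) ⊗″ φ_{N₁}(Φ₁) ∈ 𝒮(𝔸^6)`: (F1)'s two line test functions of the plane `W = ⟨dW 0, dW 1⟩` read in the big pair's
model of record through the see-saw element. -/
def slotTensor (N₀ N₁ : ℕ) :=
  cmLineTensorFin (L : Type) finProdFinEquiv e₁ (frameD V) (frameD_real V) (frameD_ne V) (dW S) (dW_real S) (dW_ne S)
    (SupplyInstance.testFun (↥(NumberField.maximalRealSubfield (L : Type))) (Fin 3) (linePhi V (dW S 0) (dW_real S 0) (dW_ne S 0) hpos₀)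
      (lineX₀ V (dW S 0) (dW_real S 0) (dW_ne S 0) hpos₀) N₀)
    (SupplyInstance.testFun (↥(NumberField.maximalRealSubfield (L : Type))) (Fin 3) (linePhi V (dW S 1) (dW_real S 1) (dW_ne S 1) hpos₁)
      (lineX₀ V (dW S 1) (dW_real S 1) (dW_ne S 1) hpos₁) N₁)

/-- (Ported verbatim from the HodgeCMPerL package; no docstring in the source.) -/
theorem slotTensor_def (N₀ N₁ : ℕ) : slotTensor V S hpos₀ hpos₁ N₀ N₁ =
    cmLineTensorFin (L : Type) finProdFinEquiv e₁ (frameD V) (frameD_real V) (frameD_ne V) (dW S) (dW_real S) (dW_ne S)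
      (SupplyInstance.testFun (↥(NumberField.maximalRealSubfield (L : Type))) (Fin 3) (linePhi V (dW S 0) (dW_real S 0) (dW_ne S 0) hpos₀)
        (lineX₀ V (dW S 0) (dW_real S 0) (dW_ne S 0) hpos₀) N₀)
      (SupplyInstance.testFun (↥(NumberField.maximalRealSubfield (L : Type))) (Fin 3) (linePhi V (dW S 1) (dW_real S 1) (dW_ne S 1) hpos₁)
        (lineX₀ V (dW S 1) (dW_real S 1) (dW_ne S 1) hpos₁) N₁) := rfl

/-- **the slot tensor is nonzero** at levels `N₀, N₁ ≠ 0`. -/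
theorem slotTensor_ne_zero {N₀ N₁ : ℕ} (hN₀ : N₀ ≠ 0) (hN₁ : N₁ ≠ 0) : slotTensor V S hpos₀ hpos₁ N₀ N₁ ≠ 0 :=
  cmLineTensorFin_ne_zero V S
    (testFun_ne_zero _ (linePhi_archEmb_lineX₀_ne_zero V (dW S 0) (dW_real S 0) (dW_ne S 0) hpos₀) hN₀)
    (testFun_ne_zero _ (linePhi_archEmb_lineX₀_ne_zero V (dW S 1) (dW_real S 1) (dW_ne S 1) hpos₁) hN₁)

/-! ## §3 the plane letters act on the slot tensor by `z ^ (slot type)` -/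

/-- the plane torus `(1, (u_{t₀}, u_{t₁}))` on the slot tensor: eigenvalue `(slotChi₀·lineC₀)(t₀) · (slotChi₁·lineC₁)(t₁)` (#1210 at (F1)'s
`line_hctr`). -/
theorem cmPairRep_planeTorus_slotTensor (N₀ N₁ : ℕ)
    (t₀ t₁ : ↥(relNormOneInfUnits (↥(NumberField.maximalRealSubfield (L : Type))) (L : Type))) :
    cmPairRep (L : Type) finProdFinEquiv (frameD V) (frameD_real V) (frameD_ne V) (dW S) (dW_real S) (dW_ne S) hGR
        (1, cmPlaneTorusIdeles (L : Type) (dW S)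
          (relNormOneInfToIdeles (↥(NumberField.maximalRealSubfield (L : Type))) (L : Type) t₀,
            relNormOneInfToIdeles (↥(NumberField.maximalRealSubfield (L : Type))) (L : Type) t₁))
        (slotTensor V S hpos₀ hpos₁ N₀ N₁) =
      ((slotChi₀ V S hGR hGR₀ hGR₁ * lineCHom V (dW S 0) (dW_real S 0) (dW_ne S 0) hGR₀) t₀ *
          (slotChi₁ V S hGR hGR₀ hGR₁ * lineCHom V (dW S 1) (dW_real S 1) (dW_ne S 1) hGR₁) t₁) •
        slotTensor V S hpos₀ hpos₁ N₀ N₁ :=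
  cmPairRep_planeTorus_lineTensorFin_testFun V S hGR hGR₀ hGR₁ _ _ _ _ _ _
    (fun N t => line_hctr V (dW S 0) (dW_real S 0) (dW_ne S 0) hGR₀ hpos₀ _ N t)
    (fun N t => line_hctr V (dW S 1) (dW_real S 1) (dW_ne S 1) hGR₁ hpos₁ _ N t) N₀ N₁ t₀ t₁

include h₁W in
/-- **the letter `(1, (ι_w(z), 1))` acts on the slot tensor by `z ^ (slot-0 type at w)`.** -/
theorem cmPairRep_planeLetter₀_slotTensor (N₀ N₁ : ℕ) (w : NumberField.InfinitePlace (L : Type)) (z : Circle) :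
    cmPairRep (L : Type) finProdFinEquiv (frameD V) (frameD_real V) (frameD_ne V) (dW S) (dW_real S) (dW_ne S) hGR
        (1, cmPlaneTorusIdeles (L : Type) (dW S)
          (relNormOneInfToIdeles (↥(NumberField.maximalRealSubfield (L : Type))) (L : Type) (archCoord (L : Type) w z),
            relNormOneInfToIdeles (↥(NumberField.maximalRealSubfield (L : Type))) (L : Type) 1))
        (slotTensor V S hpos₀ hpos₁ N₀ N₁) =
      (((z ^ (slotType (L := L) _ (continuous_slotChi₀_mul_lineCHom V S hGR hGR₀ hGR₁ h₁W) w) : Circle)) : ℂ) •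
        slotTensor V S hpos₀ hpos₁ N₀ N₁ := by
  rw [cmPairRep_planeTorus_slotTensor V S hGR hGR₀ hGR₁ hpos₀ hpos₁, map_one, mul_one, charArchType_archCoord (L : Type) _
    (continuous_slotChi₀_mul_lineCHom V S hGR hGR₀ hGR₁ h₁W)]
  rfl

include h₁W in
/-- **the letter `(1, (1, ι_w(z)))` acts on the slot tensor by `z ^ (slot-1 type at w)`.** -/
theorem cmPairRep_planeLetter₁_slotTensor (N₀ N₁ : ℕ) (w : NumberField.InfinitePlace (L : Type)) (z : Circle) :
    cmPairRep (L : Type) finProdFinEquiv (frameD V) (frameD_real V) (frameD_ne V) (dW S) (dW_real S) (dW_ne S) hGR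
        (1, cmPlaneTorusIdeles (L : Type) (dW S)
          (relNormOneInfToIdeles (↥(NumberField.maximalRealSubfield (L : Type))) (L : Type) 1,
            relNormOneInfToIdeles (↥(NumberField.maximalRealSubfield (L : Type))) (L : Type) (archCoord (L : Type) w z)))
        (slotTensor V S hpos₀ hpos₁ N₀ N₁) =
      (((z ^ (slotType (L := L) _ (continuous_slotChi₁_mul_lineCHom V S hGR hGR₀ hGR₁ h₁W) w) : Circle)) : ℂ) •
        slotTensor V S hpos₀ hpos₁ N₀ N₁ := by
  rw [cmPairRep_planeTorus_slotTensor V S hGR hGR₀ hGR₁ hpos₀ hpos₁, map_one, one_mul, charArchType_archCoord (L : Type) _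
    (continuous_slotChi₁_mul_lineCHom V S hGR hGR₀ hGR₁ h₁W)]
  rfl

include h₁W in
/-- **READ-OFF, slot 0**: if the letter `(1, (ι_w(z), 1))` acts on the (nonzero) slot tensor by `z ^ a` for all `z`, then the slot-0 type at `w` is `a`. -/
theorem slotType₀_eq_of_letter {N₀ N₁ : ℕ} (hN₀ : N₀ ≠ 0) (hN₁ : N₁ ≠ 0) (w : NumberField.InfinitePlace (L : Type)) (a : ℤ)
    (ha : ∀ z : Circle,
      cmPairRep (L : Type) finProdFinEquiv (frameD V) (frameD_real V) (frameD_ne V) (dW S) (dW_real S) (dW_ne S) hGR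
          (1, cmPlaneTorusIdeles (L : Type) (dW S)
            (relNormOneInfToIdeles (↥(NumberField.maximalRealSubfield (L : Type))) (L : Type) (archCoord (L : Type) w z),
              relNormOneInfToIdeles (↥(NumberField.maximalRealSubfield (L : Type))) (L : Type) 1))
          (slotTensor V S hpos₀ hpos₁ N₀ N₁) =
        (((z ^ a : Circle)) : ℂ) • slotTensor V S hpos₀ hpos₁ N₀ N₁) :
    slotType (L := L) _ (continuous_slotChi₀_mul_lineCHom V S hGR hGR₀ hGR₁ h₁W) w = a := by
  refine (charArchType_apply_eq_iff (L : Type) _ _ w a).2 fun z => ?_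
  have h := ha z
  rw [cmPairRep_planeLetter₀_slotTensor V S hGR hGR₀ hGR₁ hpos₀ hpos₁ h₁W] at h
  rw [charArchType_archCoord (L : Type) _ (continuous_slotChi₀_mul_lineCHom V S hGR hGR₀ hGR₁ h₁W)]
  exact smul_left_injective ℂ (slotTensor_ne_zero V S hpos₀ hpos₁ hN₀ hN₁) h

include h₁W in
/-- **READ-OFF, slot 1**: if the letter `(1, (1, ι_w(z)))` acts on the slot tensor by `z ^ b` for all `z`, then the slot-1 type at `w` is `b`. -/
theorem slotType₁_eq_of_letter {N₀ N₁ : ℕ} (hN₀ : N₀ ≠ 0) (hN₁ : N₁ ≠ 0) (w : NumberField.InfinitePlace (L : Type)) (b : ℤ)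
    (hb : ∀ z : Circle,
      cmPairRep (L : Type) finProdFinEquiv (frameD V) (frameD_real V) (frameD_ne V) (dW S) (dW_real S) (dW_ne S) hGR
          (1, cmPlaneTorusIdeles (L : Type) (dW S)
            (relNormOneInfToIdeles (↥(NumberField.maximalRealSubfield (L : Type))) (L : Type) 1,
              relNormOneInfToIdeles (↥(NumberField.maximalRealSubfield (L : Type))) (L : Type) (archCoord (L : Type) w z)))
          (slotTensor V S hpos₀ hpos₁ N₀ N₁) =
        (((z ^ b : Circle)) : ℂ) • slotTensor V S hpos₀ hpos₁ N₀ N₁) :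
    slotType (L := L) _ (continuous_slotChi₁_mul_lineCHom V S hGR hGR₀ hGR₁ h₁W) w = b := by
  refine (charArchType_apply_eq_iff (L : Type) _ _ w b).2 fun z => ?_
  have h := hb z
  rw [cmPairRep_planeLetter₁_slotTensor V S hGR hGR₀ hGR₁ hpos₀ hpos₁ h₁W] at h
  rw [charArchType_archCoord (L : Type) _ (continuous_slotChi₁_mul_lineCHom V S hGR hGR₀ hGR₁ h₁W)]
  exact smul_left_injective ℂ (slotTensor_ne_zero V S hpos₀ hpos₁ hN₀ hN₁) h

/-! ## §5 ASSEMBLY to #1213's whole-torus currency (plane) -/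

include hGR₀ hGR₁ h₁W in
/-- **per-place letters ⇒ the whole plane torus**: if for every place `w` the two plane letters act on the slot tensor by `z ^ a₀ w`,
`z ^ a₁ w`, then the plane torus `(1, (u_{t₀}, u_{t₁}))` acts by `archWeight a₀ t₀ · archWeight a₁ t₁` — the hypothesis `h` of #1213's
`slotTypeVec_sub_eq_of_planeTorus_eigen` (with `m₀ m₁ := a₀ a₁`). -/
theorem planeTorus_slotTensor_of_letters {N₀ N₁ : ℕ} (hN₀ : N₀ ≠ 0) (hN₁ : N₁ ≠ 0)
    (a₀ a₁ : NumberField.InfinitePlace (L : Type) → ℤ)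
    (ha₀ : ∀ (w : NumberField.InfinitePlace (L : Type)) (z : Circle),
      cmPairRep (L : Type) finProdFinEquiv (frameD V) (frameD_real V) (frameD_ne V) (dW S) (dW_real S) (dW_ne S) hGR
          (1, cmPlaneTorusIdeles (L : Type) (dW S)
            (relNormOneInfToIdeles (↥(NumberField.maximalRealSubfield (L : Type))) (L : Type) (archCoord (L : Type) w z), relNormOneInfToIdeles (↥(NumberField.maximalRealSubfield (L : Type))) (L : Type) 1))
          (slotTensor V S hpos₀ hpos₁ N₀ N₁) =
        (((z ^ a₀ w : Circle)) : ℂ) • slotTensor V S hpos₀ hpos₁ N₀ N₁)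
    (ha₁ : ∀ (w : NumberField.InfinitePlace (L : Type)) (z : Circle),
      cmPairRep (L : Type) finProdFinEquiv (frameD V) (frameD_real V) (frameD_ne V) (dW S) (dW_real S) (dW_ne S) hGR
          (1, cmPlaneTorusIdeles (L : Type) (dW S)
            (relNormOneInfToIdeles (↥(NumberField.maximalRealSubfield (L : Type))) (L : Type) 1, relNormOneInfToIdeles (↥(NumberField.maximalRealSubfield (L : Type))) (L : Type) (archCoord (L : Type) w z)))
          (slotTensor V S hpos₀ hpos₁ N₀ N₁) =
        (((z ^ a₁ w : Circle)) : ℂ) • slotTensor V S hpos₀ hpos₁ N₀ N₁)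
    (t₀ t₁ : ↥(relNormOneInfUnits (↥(NumberField.maximalRealSubfield (L : Type))) (L : Type))) :
    cmPairRep (L : Type) finProdFinEquiv (frameD V) (frameD_real V) (frameD_ne V) (dW S) (dW_real S) (dW_ne S) hGR
        (1, cmPlaneTorusIdeles (L : Type) (dW S) (relNormOneInfToIdeles (↥(NumberField.maximalRealSubfield (L : Type))) (L : Type) t₀, relNormOneInfToIdeles (↥(NumberField.maximalRealSubfield (L : Type))) (L : Type) t₁))
        (slotTensor V S hpos₀ hpos₁ N₀ N₁) =
      (archWeight (L : Type) a₀ t₀ * archWeight (L : Type) a₁ t₁) • slotTensor V S hpos₀ hpos₁ N₀ N₁ := by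
  have e₀ : slotChi₀ V S hGR hGR₀ hGR₁ * lineCHom V (dW S 0) (dW_real S 0) (dW_ne S 0) hGR₀ = archWeight (L : Type) a₀ :=
    ((charArchType_eq_iff (L : Type) _ (continuous_slotChi₀_mul_lineCHom V S hGR hGR₀ hGR₁ h₁W) a₀).1
      (funext fun w => slotType₀_eq_of_letter V S hGR hGR₀ hGR₁ hpos₀ hpos₁ h₁W hN₀ hN₁ w (a₀ w) (ha₀ w))).symm
  have e₁ : slotChi₁ V S hGR hGR₀ hGR₁ * lineCHom V (dW S 1) (dW_real S 1) (dW_ne S 1) hGR₁ = archWeight (L : Type) a₁ :=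
    ((charArchType_eq_iff (L : Type) _ (continuous_slotChi₁_mul_lineCHom V S hGR hGR₀ hGR₁ h₁W) a₁).1
      (funext fun w => slotType₁_eq_of_letter V S hGR hGR₀ hGR₁ hpos₀ hpos₁ h₁W hN₀ hN₁ w (a₁ w) (ha₁ w))).symm
  rw [cmPairRep_planeTorus_slotTensor V S hGR hGR₀ hGR₁ hpos₀ hpos₁, e₀, e₁]

end Plane

/-! ## §3′ the conjugated plane (slots 2, 3) -/

section ConjPlane

variable {L : CMField} {ι₁ : L →+* ℂ} (V : HermSpace3 L ι₁) (S : StubTree.SeesawDatum L)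
variable
  (hGR : (cmSplittingDatum (L : Type) finProdFinEquiv (frameD V) (frameD_real V) (frameD_ne V) (dW S) (dW_real S) (dW_ne S)).CompatibleSplitting)
  (hGR₂ : (cmSplittingDatum (L : Type) (e₁) (frameD V) (frameD_real V) (frameD_ne V) (lineVec (L : Type) (dW' S 0))
    (fun _ => dW'_real S 0) (fun _ => dW'_ne S 0)).CompatibleSplitting)
  (hGR₃ : (cmSplittingDatum (L : Type) (e₁) (frameD V) (frameD_real V) (frameD_ne V) (lineVec (L : Type) (dW' S 1))
    (fun _ => dW'_real S 1) (fun _ => dW'_ne S 1)).CompatibleSplitting)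
  (hpos₂ : 0 < HypCensus.cmXW (L : Type) (frameD V) (lineVec (L : Type) (dW' S 0)) (fun _ => dW'_real S 0) ι₁ (HypCensus.cmPlace (L : Type) ι₁) 0)
  (hpos₃ : 0 < HypCensus.cmXW (L : Type) (frameD V) (lineVec (L : Type) (dW' S 1)) (fun _ => dW'_real S 1) ι₁ (HypCensus.cmPlace (L : Type) ι₁) 0)
  (h₁W : (∀ j, 0 < (ι₁ (dW S j)).re) ∨ ∀ j, (ι₁ (dW S j)).re < 0)

/-- **the conjugated slot tensor** `φ_{N₀}(Φ₂) ⊗″ φ_{N₁}(Φ₃) ∈ 𝒮(𝔸^6)`: (F1)'s line test functions of the primed basis `(dW' 0, dW' 1)` of `W`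
read through the conjugated see-saw element (`g₀ = S.isoGL`). -/
def conjSlotTensor (N₀ N₁ : ℕ) :=
  cmConjLineTensorFin (L : Type) finProdFinEquiv e₁ (frameD V) (frameD_real V) (frameD_ne V) (dW S) (dW_real S) (dW_ne S)
    (dW' S) (dW'_real S) (dW'_ne S) S.isoGL (isoGL_hg₀ S)
    (SupplyInstance.testFun (↥(NumberField.maximalRealSubfield (L : Type))) (Fin 3) (linePhi V (dW' S 0) (dW'_real S 0) (dW'_ne S 0) hpos₂)
      (lineX₀ V (dW' S 0) (dW'_real S 0) (dW'_ne S 0) hpos₂) N₀)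
    (SupplyInstance.testFun (↥(NumberField.maximalRealSubfield (L : Type))) (Fin 3) (linePhi V (dW' S 1) (dW'_real S 1) (dW'_ne S 1) hpos₃)
      (lineX₀ V (dW' S 1) (dW'_real S 1) (dW'_ne S 1) hpos₃) N₁)

/-- (Ported verbatim from the HodgeCMPerL package; no docstring in the source.) -/
theorem conjSlotTensor_def (N₀ N₁ : ℕ) : conjSlotTensor V S hpos₂ hpos₃ N₀ N₁ =
    cmConjLineTensorFin (L : Type) finProdFinEquiv e₁ (frameD V) (frameD_real V) (frameD_ne V) (dW S) (dW_real S) (dW_ne S)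
      (dW' S) (dW'_real S) (dW'_ne S) S.isoGL (isoGL_hg₀ S)
      (SupplyInstance.testFun (↥(NumberField.maximalRealSubfield (L : Type))) (Fin 3) (linePhi V (dW' S 0) (dW'_real S 0) (dW'_ne S 0) hpos₂)
        (lineX₀ V (dW' S 0) (dW'_real S 0) (dW'_ne S 0) hpos₂) N₀)
      (SupplyInstance.testFun (↥(NumberField.maximalRealSubfield (L : Type))) (Fin 3) (linePhi V (dW' S 1) (dW'_real S 1) (dW'_ne S 1) hpos₃)
        (lineX₀ V (dW' S 1) (dW'_real S 1) (dW'_ne S 1) hpos₃) N₁) := rfl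

/-- **the conjugated slot tensor is nonzero** at levels `N₀, N₁ ≠ 0`. -/
theorem conjSlotTensor_ne_zero {N₀ N₁ : ℕ} (hN₀ : N₀ ≠ 0) (hN₁ : N₁ ≠ 0) : conjSlotTensor V S hpos₂ hpos₃ N₀ N₁ ≠ 0 :=
  cmConjLineTensorFin_ne_zero V S
    (testFun_ne_zero _ (linePhi_archEmb_lineX₀_ne_zero V (dW' S 0) (dW'_real S 0) (dW'_ne S 0) hpos₂) hN₀)
    (testFun_ne_zero _ (linePhi_archEmb_lineX₀_ne_zero V (dW' S 1) (dW'_real S 1) (dW'_ne S 1) hpos₃) hN₁)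

/-- the conjugated plane torus on the conjugated slot tensor: eigenvalue `(slotChi₂·lineC₂)(t₀) · (slotChi₃·lineC₃)(t₁)` (#1210 twin at (F1)'s
`line_hctr`). -/
theorem cmPairRep_conjPlaneTorus_conjSlotTensor (N₀ N₁ : ℕ)
    (t₀ t₁ : ↥(relNormOneInfUnits (↥(NumberField.maximalRealSubfield (L : Type))) (L : Type))) :
    cmPairRep (L : Type) finProdFinEquiv (frameD V) (frameD_real V) (frameD_ne V) (dW S) (dW_real S) (dW_ne S) hGR
        (1, cmConjPlaneTorusIdeles (L : Type) (dW S) (dW' S) S.isoGL (isoGL_hg₀ S)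
          (relNormOneInfToIdeles (↥(NumberField.maximalRealSubfield (L : Type))) (L : Type) t₀,
            relNormOneInfToIdeles (↥(NumberField.maximalRealSubfield (L : Type))) (L : Type) t₁))
        (conjSlotTensor V S hpos₂ hpos₃ N₀ N₁) =
      ((slotChi₂ V S hGR hGR₂ hGR₃ * lineCHom V (dW' S 0) (dW'_real S 0) (dW'_ne S 0) hGR₂) t₀ *
          (slotChi₃ V S hGR hGR₂ hGR₃ * lineCHom V (dW' S 1) (dW'_real S 1) (dW'_ne S 1) hGR₃) t₁) •
        conjSlotTensor V S hpos₂ hpos₃ N₀ N₁ :=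
  cmPairRep_conjPlaneTorus_lineTensorFin_testFun V S hGR hGR₂ hGR₃ _ _ _ _ _ _
    (fun N t => line_hctr V (dW' S 0) (dW'_real S 0) (dW'_ne S 0) hGR₂ hpos₂ _ N t)
    (fun N t => line_hctr V (dW' S 1) (dW'_real S 1) (dW'_ne S 1) hGR₃ hpos₃ _ N t) N₀ N₁ t₀ t₁

include h₁W in
/-- **the conjugated letter `(1, g₀ (ι_w(z), 1) g₀⁻¹)` acts on the conjugated slot tensor by `z ^ (slot-2 type at w)`.** -/
theorem cmPairRep_conjPlaneLetter₀_conjSlotTensor (N₀ N₁ : ℕ) (w : NumberField.InfinitePlace (L : Type)) (z : Circle) :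
    cmPairRep (L : Type) finProdFinEquiv (frameD V) (frameD_real V) (frameD_ne V) (dW S) (dW_real S) (dW_ne S) hGR
        (1, cmConjPlaneTorusIdeles (L : Type) (dW S) (dW' S) S.isoGL (isoGL_hg₀ S)
          (relNormOneInfToIdeles (↥(NumberField.maximalRealSubfield (L : Type))) (L : Type) (archCoord (L : Type) w z),
            relNormOneInfToIdeles (↥(NumberField.maximalRealSubfield (L : Type))) (L : Type) 1))
        (conjSlotTensor V S hpos₂ hpos₃ N₀ N₁) =
      (((z ^ (slotType (L := L) _ (continuous_slotChi₂_mul_lineCHom V S hGR hGR₂ hGR₃ h₁W) w) : Circle)) : ℂ) •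
        conjSlotTensor V S hpos₂ hpos₃ N₀ N₁ := by
  rw [cmPairRep_conjPlaneTorus_conjSlotTensor V S hGR hGR₂ hGR₃ hpos₂ hpos₃, map_one, mul_one, charArchType_archCoord (L : Type) _
    (continuous_slotChi₂_mul_lineCHom V S hGR hGR₂ hGR₃ h₁W)]
  rfl

include h₁W in
/-- **the conjugated letter `(1, g₀ (1, ι_w(z)) g₀⁻¹)` acts on the conjugated slot tensor by `z ^ (slot-3 type at w)`.** -/
theorem cmPairRep_conjPlaneLetter₁_conjSlotTensor (N₀ N₁ : ℕ) (w : NumberField.InfinitePlace (L : Type)) (z : Circle) :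
    cmPairRep (L : Type) finProdFinEquiv (frameD V) (frameD_real V) (frameD_ne V) (dW S) (dW_real S) (dW_ne S) hGR
        (1, cmConjPlaneTorusIdeles (L : Type) (dW S) (dW' S) S.isoGL (isoGL_hg₀ S)
          (relNormOneInfToIdeles (↥(NumberField.maximalRealSubfield (L : Type))) (L : Type) 1,
            relNormOneInfToIdeles (↥(NumberField.maximalRealSubfield (L : Type))) (L : Type) (archCoord (L : Type) w z)))
        (conjSlotTensor V S hpos₂ hpos₃ N₀ N₁) =
      (((z ^ (slotType (L := L) _ (continuous_slotChi₃_mul_lineCHom V S hGR hGR₂ hGR₃ h₁W) w) : Circle)) : ℂ) •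
        conjSlotTensor V S hpos₂ hpos₃ N₀ N₁ := by
  rw [cmPairRep_conjPlaneTorus_conjSlotTensor V S hGR hGR₂ hGR₃ hpos₂ hpos₃, map_one, one_mul, charArchType_archCoord (L : Type) _
    (continuous_slotChi₃_mul_lineCHom V S hGR hGR₂ hGR₃ h₁W)]
  rfl

include h₁W in
/-- **READ-OFF, slot 2.** -/
theorem slotType₂_eq_of_letter {N₀ N₁ : ℕ} (hN₀ : N₀ ≠ 0) (hN₁ : N₁ ≠ 0) (w : NumberField.InfinitePlace (L : Type)) (a : ℤ)
    (ha : ∀ z : Circle,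
      cmPairRep (L : Type) finProdFinEquiv (frameD V) (frameD_real V) (frameD_ne V) (dW S) (dW_real S) (dW_ne S) hGR
          (1, cmConjPlaneTorusIdeles (L : Type) (dW S) (dW' S) S.isoGL (isoGL_hg₀ S)
            (relNormOneInfToIdeles (↥(NumberField.maximalRealSubfield (L : Type))) (L : Type) (archCoord (L : Type) w z),
              relNormOneInfToIdeles (↥(NumberField.maximalRealSubfield (L : Type))) (L : Type) 1))
          (conjSlotTensor V S hpos₂ hpos₃ N₀ N₁) =
        (((z ^ a : Circle)) : ℂ) • conjSlotTensor V S hpos₂ hpos₃ N₀ N₁) :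
    slotType (L := L) _ (continuous_slotChi₂_mul_lineCHom V S hGR hGR₂ hGR₃ h₁W) w = a := by
  refine (charArchType_apply_eq_iff (L : Type) _ _ w a).2 fun z => ?_
  have h := ha z
  rw [cmPairRep_conjPlaneLetter₀_conjSlotTensor V S hGR hGR₂ hGR₃ hpos₂ hpos₃ h₁W] at h
  rw [charArchType_archCoord (L : Type) _ (continuous_slotChi₂_mul_lineCHom V S hGR hGR₂ hGR₃ h₁W)]
  exact smul_left_injective ℂ (conjSlotTensor_ne_zero V S hpos₂ hpos₃ hN₀ hN₁) h

include h₁W in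
/-- **READ-OFF, slot 3.** -/
theorem slotType₃_eq_of_letter {N₀ N₁ : ℕ} (hN₀ : N₀ ≠ 0) (hN₁ : N₁ ≠ 0) (w : NumberField.InfinitePlace (L : Type)) (b : ℤ)
    (hb : ∀ z : Circle,
      cmPairRep (L : Type) finProdFinEquiv (frameD V) (frameD_real V) (frameD_ne V) (dW S) (dW_real S) (dW_ne S) hGR
          (1, cmConjPlaneTorusIdeles (L : Type) (dW S) (dW' S) S.isoGL (isoGL_hg₀ S)
            (relNormOneInfToIdeles (↥(NumberField.maximalRealSubfield (L : Type))) (L : Type) 1,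
              relNormOneInfToIdeles (↥(NumberField.maximalRealSubfield (L : Type))) (L : Type) (archCoord (L : Type) w z)))
          (conjSlotTensor V S hpos₂ hpos₃ N₀ N₁) =
        (((z ^ b : Circle)) : ℂ) • conjSlotTensor V S hpos₂ hpos₃ N₀ N₁) :
    slotType (L := L) _ (continuous_slotChi₃_mul_lineCHom V S hGR hGR₂ hGR₃ h₁W) w = b := by
  refine (charArchType_apply_eq_iff (L : Type) _ _ w b).2 fun z => ?_
  have h := hb z
  rw [cmPairRep_conjPlaneLetter₁_conjSlotTensor V S hGR hGR₂ hGR₃ hpos₂ hpos₃ h₁W] at h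
  rw [charArchType_archCoord (L : Type) _ (continuous_slotChi₃_mul_lineCHom V S hGR hGR₂ hGR₃ h₁W)]
  exact smul_left_injective ℂ (conjSlotTensor_ne_zero V S hpos₂ hpos₃ hN₀ hN₁) h

/-! ## §5′ ASSEMBLY to #1213's whole-torus currency (conjugated plane) -/

include hGR₂ hGR₃ h₁W in
/-- **per-place conjugated letters ⇒ the whole conjugated plane torus**: the hypothesis `h'` of #1213's
`slotTypeVec_sub_eq_of_conjPlaneTorus_eigen` (with `m₂ m₃ := a₂ a₃`). -/
theorem conjPlaneTorus_conjSlotTensor_of_letters {N₀ N₁ : ℕ} (hN₀ : N₀ ≠ 0) (hN₁ : N₁ ≠ 0)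
    (a₂ a₃ : NumberField.InfinitePlace (L : Type) → ℤ)
    (ha₂ : ∀ (w : NumberField.InfinitePlace (L : Type)) (z : Circle),
      cmPairRep (L : Type) finProdFinEquiv (frameD V) (frameD_real V) (frameD_ne V) (dW S) (dW_real S) (dW_ne S) hGR
          (1, cmConjPlaneTorusIdeles (L : Type) (dW S) (dW' S) S.isoGL (isoGL_hg₀ S)
            (relNormOneInfToIdeles (↥(NumberField.maximalRealSubfield (L : Type))) (L : Type) (archCoord (L : Type) w z), relNormOneInfToIdeles (↥(NumberField.maximalRealSubfield (L : Type))) (L : Type) 1))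
          (conjSlotTensor V S hpos₂ hpos₃ N₀ N₁) =
        (((z ^ a₂ w : Circle)) : ℂ) • conjSlotTensor V S hpos₂ hpos₃ N₀ N₁)
    (ha₃ : ∀ (w : NumberField.InfinitePlace (L : Type)) (z : Circle),
      cmPairRep (L : Type) finProdFinEquiv (frameD V) (frameD_real V) (frameD_ne V) (dW S) (dW_real S) (dW_ne S) hGR
          (1, cmConjPlaneTorusIdeles (L : Type) (dW S) (dW' S) S.isoGL (isoGL_hg₀ S)
            (relNormOneInfToIdeles (↥(NumberField.maximalRealSubfield (L : Type))) (L : Type) 1, relNormOneInfToIdeles (↥(NumberField.maximalRealSubfield (L : Type))) (L : Type) (archCoord (L : Type) w z)))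
          (conjSlotTensor V S hpos₂ hpos₃ N₀ N₁) =
        (((z ^ a₃ w : Circle)) : ℂ) • conjSlotTensor V S hpos₂ hpos₃ N₀ N₁)
    (t₀ t₁ : ↥(relNormOneInfUnits (↥(NumberField.maximalRealSubfield (L : Type))) (L : Type))) :
    cmPairRep (L : Type) finProdFinEquiv (frameD V) (frameD_real V) (frameD_ne V) (dW S) (dW_real S) (dW_ne S) hGR
        (1, cmConjPlaneTorusIdeles (L : Type) (dW S) (dW' S) S.isoGL (isoGL_hg₀ S) (relNormOneInfToIdeles (↥(NumberField.maximalRealSubfield (L : Type))) (L : Type) t₀, relNormOneInfToIdeles (↥(NumberField.maximalRealSubfield (L : Type))) (L : Type) t₁))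
        (conjSlotTensor V S hpos₂ hpos₃ N₀ N₁) =
      (archWeight (L : Type) a₂ t₀ * archWeight (L : Type) a₃ t₁) • conjSlotTensor V S hpos₂ hpos₃ N₀ N₁ := by
  have e₂ : slotChi₂ V S hGR hGR₂ hGR₃ * lineCHom V (dW' S 0) (dW'_real S 0) (dW'_ne S 0) hGR₂ = archWeight (L : Type) a₂ :=
    ((charArchType_eq_iff (L : Type) _ (continuous_slotChi₂_mul_lineCHom V S hGR hGR₂ hGR₃ h₁W) a₂).1
      (funext fun w => slotType₂_eq_of_letter V S hGR hGR₂ hGR₃ hpos₂ hpos₃ h₁W hN₀ hN₁ w (a₂ w) (ha₂ w))).symm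
  have e₃ : slotChi₃ V S hGR hGR₂ hGR₃ * lineCHom V (dW' S 1) (dW'_real S 1) (dW'_ne S 1) hGR₃ = archWeight (L : Type) a₃ :=
    ((charArchType_eq_iff (L : Type) _ (continuous_slotChi₃_mul_lineCHom V S hGR hGR₂ hGR₃ h₁W) a₃).1
      (funext fun w => slotType₃_eq_of_letter V S hGR hGR₂ hGR₃ hpos₂ hpos₃ h₁W hN₀ hN₁ w (a₃ w) (ha₃ w))).symm
  rw [cmPairRep_conjPlaneTorus_conjSlotTensor V S hGR hGR₂ hGR₃ hpos₂ hpos₃, e₂, e₃]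

end ConjPlane

/-! ## §4 THE (J-μ) RESIDUAL IN LETTER FORM: E's three differences `slotTypeVec k − slotTypeVec 0` from four letter exponents -/

section Residual

variable {L : CMField} {ι₁ : L →+* ℂ} (V : HermSpace3 L ι₁) (c : SeesawCtx L)

-- port_pkg: scope closed for this part
end Residual
end HodgeCM.Model.ArchSideTerm
end
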